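import Literature.Probability.Percolation.OneArmSeriesSolution
import Literature.Analysis.SpecialFunctions.JacobiHeatOrder
import Literature.Probability.Percolation.OneArmHittingPDE
import HarnessLib

/-!
# LSW Lemma 2.2 / (2.3) / (2.12), analytic half: the semigroup solution and its `IsHittingPDEData`

Topic `Literature/Probability/Percolation`; family `crit-perc`. This file assembles the analytic
half of the discharge of the named fact
`Literature.Probability.Percolation.LawlerSchrammWerner2002_hittingPDE` (`OneArmHittingPDE.lean`;
Lawler–Schramm–Werner, *One-arm exponent for critical 2D percolation*, Electron. J. Probab. 7
(2002), paper no. 2, §2). That fact asks, for the weak limit `ν` of `lswLaw`, for functions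
`h, h_θ, h_θθ, h_t` with the regularity, PDE (2.4), boundary behaviour (2.3)/(2.12), monotonicity,
bounds and positivity of LSW's `h(θ, t) = P[𝔯(θ) ≤ e^{-t}]` ((2.2)), AND the identification
`h(2π, t) = ν{𝔯 ≤ e^{-t}}`. Everything except the identification is a statement about the
semigroup of the radial Bessel process (2.11) killed at `θ = 0` and reflected at `θ = 2π`
("The theory of diffusion processes and (2.10), (2.11) imply that `h(θ,t)` is smooth", p. 6),
and is PROVED here for the explicit series solution built in this tree:

  `u(θ, t) = e^{-λ t} sin(θ/4)^q Y(sin²(θ/4), t) = Σ_n γ_n e^{-λ_n t} φ_n(θ)`  (`t > 0`),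
  `u(θ, t) = 1` (`t ≤ 0`),

`κ = 6`, `λ = 5/48`, `q = 1/3`, `c = 7/6`, with the eigenfunctions `φ_n` of
`OneArmEigenfunctions.lean`, the Jacobi heat series `Y` of
`Literature/Analysis/SpecialFunctions/JacobiHeatSeries.lean` and the coefficients
`γ_n = ⟨1, φ_n⟩/‖φ_n‖²` (`jacobiInitCoeff`) of the constant initial datum `1` — i.e. `u = P_t 1`,
the survival function of the killed/reflected diffusion started from `θ`:

* `isHittingPDEData_lswHit` — **`IsHittingPDEData (lswHit 6) …`**: `u(θ, ·)` non-increasing,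
  `0 ≤ u ≤ 1`, `u > 0` on `(0, 2π] × ℝ` (indeed `u(θ,t) ≥ e^{-λt} sin(θ/4)^q`, LSW's lower
  comparison function `H`), `C^{2,1}` with continuous derivatives and the PDE (2.4) on the open
  strip, (2.3) at `θ = 0`, and the one-sided Neumann condition of the window average
  `∫₀¹ u(θ, t+s) ds` at `θ = 2π` (Lemma 2.3's conclusion (2.12), here exact for `u`);
* `LawlerSchrammWerner2002_hittingPDE_of_trace` — the named fact REDUCED to the pure
  identification `∀ t, u(2π, t) = ν{K | 𝔯(K) ≤ e^{-t}}` of the distribution function of the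
  conformal radius under the scaling limit with the trace of the semigroup solution (the content
  of LSW Thm. 2.1, (2.7)–(2.10) and Lemma 2.3, which needs the convergence of the exploration path
  to `SLE₆` and is not available in this tree).

No named fact is introduced; the reduction's hypothesis is explicit.

## References

* G. F. Lawler, O. Schramm, W. Werner, *One-arm exponent for critical 2D percolation*, Electron.
  J. Probab. 7 (2002), no. 2, §2: (2.2)–(2.4), Lemma 2.2, (2.10)–(2.12), Lemma 2.3, p. 7 (`H`).
  [LawlerSchrammWernerEJP2002]
-/

noncomputable section

open Real Set Filter MeasureTheory intervalIntegral
open scoped Topology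

namespace Literature.Probability.Percolation

open Literature.Analysis.SpecialFunctions

/-! ### Parameters and the clamp to `[0, 2π]` -/

/-- `λ = (κ/8)(c - 1)(2 - c)` with `c = 3/2 - 2/κ`: LSW's exponent is the rate of the flux
identity of `JacobiHeatPositivity`. [folklore] -/
theorem lswLambda_eq_heat {κ : ℝ} (hκ : κ ≠ 0) :
    lswLambda κ = κ / 8 * (lswJacobiParam κ - 1) * (2 - lswJacobiParam κ) := by
  unfold lswLambda lswJacobiParam; field_simp; ring

/-- `q = 2(c - 1)`. [folklore] -/
theorem lswQ_eq_two_mul {κ : ℝ} (hκ : κ ≠ 0) : lswQ κ = 2 * (lswJacobiParam κ - 1) := by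
  unfold lswQ lswJacobiParam; field_simp; ring

/-- The clamp `θ ↦ max 0 (min θ 2π)` onto `[0, 2π]` (so that `lswHit` is defined by the series
only through angles in `[0, 2π]`; it is the identity there). [folklore] -/
def clampTwoPi (θ : ℝ) : ℝ := max 0 (min θ (2 * π))

/-- The clamp is the identity on `[0, 2π]`. [folklore] -/
theorem clampTwoPi_of_mem {θ : ℝ} (hθ : θ ∈ Icc 0 (2 * π)) : clampTwoPi θ = θ := by
  unfold clampTwoPi; rw [min_eq_left hθ.2, max_eq_right hθ.1]

/-- The clamp lands in `[0, 2π]`. [folklore] -/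
theorem clampTwoPi_mem (θ : ℝ) : clampTwoPi θ ∈ Icc 0 (2 * π) :=
  ⟨le_max_left _ _, max_le (by positivity) (min_le_right _ _)⟩

/-- Near an interior angle the clamp is eventually the identity. [folklore] -/
theorem clampTwoPi_eventuallyEq {θ : ℝ} (hθ : θ ∈ Ioo 0 (2 * π)) :
    (fun x => clampTwoPi x) =ᶠ[𝓝 θ] fun x => x := by
  filter_upwards [Ioo_mem_nhds hθ.1 hθ.2] with x hx
  exact clampTwoPi_of_mem (Ioo_subset_Icc_self hx)

/-! ### The solution `u = P_t 1` and its derivative fields -/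

/-- The coefficients `γ_n = ⟨1, φ_n⟩/‖φ_n‖²` of the constant initial datum (`jacobiInitCoeff` at
`c = 3/2 - 2/κ`). [folklore] -/
abbrev lswInitCoeff (κ : ℝ) : ℕ → ℝ := jacobiInitCoeff (lswJacobiParam κ)

/-- **The semigroup solution** `u(θ, t) = P_t 1(θ)`: `1` for `t ≤ 0`, the series solution
`Σ γ_n e^{-λ_n t} φ_n` (at the clamped angle) for `t > 0`.
[cite: LawlerSchrammWernerEJP2002, Lemma 2.2, (2.2)] -/
def lswHit (κ θ t : ℝ) : ℝ :=
  if t ≤ 0 then 1 else lswSeries κ (lswInitCoeff κ) (clampTwoPi θ) t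

/-- `∂_θ u` (on the open strip). [folklore] -/
def lswHitDθ (κ θ t : ℝ) : ℝ := lswSeriesDθ κ (lswInitCoeff κ) θ t
/-- `∂²_θ u` (on the open strip). [folklore] -/
def lswHitDθθ (κ θ t : ℝ) : ℝ := lswSeriesDθθ κ (lswInitCoeff κ) θ t
/-- `∂ₜ u` (on the open strip). [folklore] -/
def lswHitDt (κ θ t : ℝ) : ℝ := lswSeriesDt κ (lswInitCoeff κ) θ t

section Order

variable {κ : ℝ} (hκ : 4 < κ)
include hκ

/-- `1 < c` for `κ > 4` (abbreviation). [folklore] -/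
private theorem hc1A : 1 < lswJacobiParam κ := one_lt_lswJacobiParam hκ
/-- `c < 2` (abbreviation). [folklore] -/
private theorem hc2A : lswJacobiParam κ < 2 := lswJacobiParam_lt_two (by linarith)
/-- `0 < κ/8` (abbreviation). [folklore] -/
private theorem hμA : 0 < κ / 8 := by linarith

/-- The coefficient hypothesis for `γ = lswInitCoeff κ`. [folklore] -/
theorem lswInitCoeff_hyp :
    ∀ n, lswInitCoeff κ n ^ 2 * hypJacobiNormSq (lswJacobiParam κ) n ≤
      jacobiInitNormSq (lswJacobiParam κ) :=
  init_hγ (hc1A hκ) (hc2A hκ)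

omit hκ in
/-- The series solution in terms of `initHeat`: `u = e^{-λt} sin(θ/4)^q Y(sin²(θ/4), t)`.
[folklore] -/
theorem lswSeries_init_eq (θ t : ℝ) :
    lswSeries κ (lswInitCoeff κ) θ t = Real.exp (-(lswLambda κ * t)) *
      (Real.sin (θ / 4) ^ lswQ κ * initHeat (lswJacobiParam κ) (κ / 8) (Real.sin (θ / 4) ^ 2) t) :=
  rfl

/-- **Lower bound `u ≥ H`**: `e^{-λt} sin(θ/4)^q ≤ u(θ, t)` for `θ ∈ (0, 2π]`, `t > 0` (`Y ≥ 1`);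
LSW's lower comparison with `H` (p. 7). [cite: LawlerSchrammWernerEJP2002, proof of Thm. 1.2 (2.17)] -/
theorem lswH_le_lswSeries_init {θ t : ℝ} (hθ : θ ∈ Ioc 0 (2 * π)) (ht : 0 < t) :
    Real.exp (-(lswLambda κ * t)) * Real.sin (θ / 4) ^ lswQ κ ≤ lswSeries κ (lswInitCoeff κ) θ t := by
  have hs : 0 < Real.sin (θ / 4) := sin_quarter_pos hθ.1 hθ.2
  have hz : Real.sin (θ / 4) ^ 2 ∈ Ioc (0 : ℝ) 1 :=
    ⟨by positivity, by nlinarith [Real.sin_sq_add_cos_sq (θ / 4), Real.sin_le_one (θ / 4)]⟩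
  have hY := one_le_initHeat (hc1A hκ) (hc2A hκ) (hμA hκ) ht hz
  rw [lswSeries_init_eq]
  have h0 : 0 ≤ Real.exp (-(lswLambda κ * t)) * Real.sin (θ / 4) ^ lswQ κ := by positivity
  calc _ = Real.exp (-(lswLambda κ * t)) * Real.sin (θ / 4) ^ lswQ κ * 1 := (mul_one _).symm
    _ ≤ Real.exp (-(lswLambda κ * t)) * Real.sin (θ / 4) ^ lswQ κ *
          initHeat (lswJacobiParam κ) (κ / 8) (Real.sin (θ / 4) ^ 2) t :=
        mul_le_mul_of_nonneg_left hY h0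
    _ = _ := by ring

/-- **`u > 0`** on `(0, 2π] × (0, ∞)`. [folklore] -/
theorem lswSeries_init_pos {θ t : ℝ} (hθ : θ ∈ Ioc 0 (2 * π)) (ht : 0 < t) :
    0 < lswSeries κ (lswInitCoeff κ) θ t :=
  (mul_pos (Real.exp_pos _) (Real.rpow_pos_of_pos (sin_quarter_pos hθ.1 hθ.2) _)).trans_le
    (lswH_le_lswSeries_init hκ hθ ht)

/-- **`u ≤ 1`** on `(0, 2π] × (0, ∞)` (`e^{-λt} Y(z,t) ≤ z^{1-c}` and `q = 2(c-1)`). [folklore] -/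
theorem lswSeries_init_le_one {θ t : ℝ} (hθ : θ ∈ Ioc 0 (2 * π)) (ht : 0 < t) :
    lswSeries κ (lswInitCoeff κ) θ t ≤ 1 := by
  have hκ0 : κ ≠ 0 := by linarith
  have hs : 0 < Real.sin (θ / 4) := sin_quarter_pos hθ.1 hθ.2
  have hz : Real.sin (θ / 4) ^ 2 ∈ Ioc (0 : ℝ) 1 :=
    ⟨by positivity, by nlinarith [Real.sin_sq_add_cos_sq (θ / 4), Real.sin_le_one (θ / 4)]⟩
  have hY := exp_mul_initHeat_le (hc1A hκ) (hc2A hκ) (hμA hκ) ht hz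
  rw [← lswLambda_eq_heat hκ0] at hY
  rw [lswSeries_init_eq, show Real.exp (-(lswLambda κ * t)) * (Real.sin (θ / 4) ^ lswQ κ *
      initHeat (lswJacobiParam κ) (κ / 8) (Real.sin (θ / 4) ^ 2) t)
    = Real.sin (θ / 4) ^ lswQ κ * (Real.exp (-(lswLambda κ * t)) *
      initHeat (lswJacobiParam κ) (κ / 8) (Real.sin (θ / 4) ^ 2) t) by ring]
  calc _ ≤ Real.sin (θ / 4) ^ lswQ κ * (Real.sin (θ / 4) ^ 2) ^ (1 - lswJacobiParam κ) :=
        mul_le_mul_of_nonneg_left hY (Real.rpow_nonneg hs.le _)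
    _ = 1 := by
        rw [← Real.rpow_natCast, ← Real.rpow_mul hs.le, ← Real.rpow_add hs, lswQ_eq_two_mul hκ0]
        push_cast
        rw [show 2 * (lswJacobiParam κ - 1) + 2 * (1 - lswJacobiParam κ) = 0 by ring, Real.rpow_zero]

/-- **`u(θ, ·)` is non-increasing on `(0, ∞)`** for `θ ∈ (0, 2π]`. [folklore] -/
theorem lswSeries_init_antitone {θ t₁ t₂ : ℝ} (hθ : θ ∈ Ioc 0 (2 * π)) (ht₁ : 0 < t₁)
    (h12 : t₁ ≤ t₂) :
    lswSeries κ (lswInitCoeff κ) θ t₂ ≤ lswSeries κ (lswInitCoeff κ) θ t₁ := by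
  have hκ0 : κ ≠ 0 := by linarith
  have hs : 0 < Real.sin (θ / 4) := sin_quarter_pos hθ.1 hθ.2
  have hz : Real.sin (θ / 4) ^ 2 ∈ Ioc (0 : ℝ) 1 :=
    ⟨by positivity, by nlinarith [Real.sin_sq_add_cos_sq (θ / 4), Real.sin_le_one (θ / 4)]⟩
  have hY := exp_mul_initHeat_antitone (hc1A hκ) (hc2A hκ) (hμA hκ) ht₁ h12 hz
  rw [← lswLambda_eq_heat hκ0] at hY
  rw [lswSeries_init_eq, lswSeries_init_eq]
  have := mul_le_mul_of_nonneg_left hY (Real.rpow_nonneg hs.le (lswQ κ))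
  nlinarith [this]

/-- `u = 0` at `θ = 0` (`t` arbitrary in the series). [folklore] -/
theorem lswSeries_init_zero (t : ℝ) : lswSeries κ (lswInitCoeff κ) 0 t = 0 :=
  lswSeries_zero_left hκ t

end Order

/-! ### `IsHittingPDEData` for `κ = 6` -/

section Six

/-- `4 < 6`. [folklore] -/
private theorem h6 : (4 : ℝ) < 6 := by norm_num

/-- `u(θ, t)` for `t > 0` and `θ ∈ [0, 2π]` is the series. [folklore] -/
theorem lswHit_of_pos {θ t : ℝ} (ht : 0 < t) (hθ : θ ∈ Icc 0 (2 * π)) :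
    lswHit 6 θ t = lswSeries 6 (lswInitCoeff 6) θ t := by
  rw [lswHit, if_neg (not_le.2 ht), clampTwoPi_of_mem hθ]

/-- `u(θ, t) ∈ [0, 1]` and the case analysis at the clamped angle. [folklore] -/
theorem lswHit_mem_Icc (θ t : ℝ) : lswHit 6 θ t ∈ Icc (0 : ℝ) 1 := by
  unfold lswHit
  split_ifs with ht
  · exact ⟨zero_le_one, le_rfl⟩
  · push Not at ht
    have hmem := clampTwoPi_mem θ
    rcases hmem.1.eq_or_lt with h0 | h0
    · rw [← h0, lswSeries_init_zero h6]; exact ⟨le_rfl, zero_le_one⟩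
    · exact ⟨(lswSeries_init_pos h6 ⟨h0, hmem.2⟩ ht).le, lswSeries_init_le_one h6 ⟨h0, hmem.2⟩ ht⟩

/-- **(2.2)-monotonicity**: `u(θ, ·)` is non-increasing, for every real `θ`. [folklore] -/
theorem antitone_lswHit (θ : ℝ) : Antitone (lswHit 6 θ) := by
  intro t₁ t₂ h12
  by_cases ht₂ : t₂ ≤ 0
  · have ht₁ : t₁ ≤ 0 := h12.trans ht₂
    simp [lswHit, ht₁, ht₂]
  · push Not at ht₂
    by_cases ht₁ : t₁ ≤ 0
    · rw [show lswHit 6 θ t₁ = 1 by simp [lswHit, ht₁]]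
      exact (lswHit_mem_Icc θ t₂).2
    · push Not at ht₁
      rw [lswHit, if_neg (not_le.2 ht₂), lswHit, if_neg (not_le.2 ht₁)]
      have hmem := clampTwoPi_mem θ
      rcases hmem.1.eq_or_lt with h0 | h0
      · rw [← h0, lswSeries_init_zero h6, lswSeries_init_zero h6]
      · exact lswSeries_init_antitone h6 ⟨h0, hmem.2⟩ ht₁ h12

/-- **Positivity**: `u > 0` on `(0, 2π] × ℝ`. [folklore] -/
theorem lswHit_pos {θ : ℝ} (hθ : θ ∈ Ioc 0 (2 * π)) (t : ℝ) : 0 < lswHit 6 θ t := by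
  unfold lswHit
  split_ifs with ht
  · exact one_pos
  · rw [clampTwoPi_of_mem ⟨hθ.1.le, hθ.2⟩]
    exact lswSeries_init_pos h6 hθ (not_le.1 ht)

/-- `s ↦ u(θ, s)` is continuous on `(0, ∞)` for `θ ∈ (0, 2π]`. [folklore] -/
theorem continuousOn_lswSeries_init_t {θ : ℝ} (hθ : θ ∈ Ioc 0 (2 * π)) :
    ContinuousOn (fun s => lswSeries 6 (lswInitCoeff 6) θ s) (Ioi 0) := by
  have hs : 0 < Real.sin (θ / 4) := sin_quarter_pos hθ.1 hθ.2
  have hz : Real.sin (θ / 4) ^ 2 ∈ Ioc (0 : ℝ) 1 :=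
    ⟨by positivity, by nlinarith [Real.sin_sq_add_cos_sq (θ / 4), Real.sin_le_one (θ / 4)]⟩
  have hY : ContinuousOn (fun s => initHeat (lswJacobiParam 6) (6 / 8) (Real.sin (θ / 4) ^ 2) s)
      (Ioi 0) :=
    (continuousOn_jacobiHeat' (hc1A h6) (hc2A h6) (hμA h6) (lswInitCoeff_hyp h6)).comp
      (Continuous.prodMk_right _).continuousOn fun s hs' => ⟨hz, hs'⟩
  simp_rw [lswSeries_init_eq]
  exact ContinuousOn.mul (Continuous.continuousOn (by fun_prop)) (continuousOn_const.mul hY)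

/-- **The analytic half of `LawlerSchrammWerner2002_hittingPDE`**: the semigroup solution
`u = lswHit 6` with its derivative fields satisfies every analytic clause of the named fact —
monotonicity, `0 ≤ u ≤ 1`, positivity on `(0, 2π]`, `C^{2,1}` regularity with continuous
derivatives and LSW's PDE (2.4) (`κ = 6`) on `(0, 2π) × (0, ∞)`, the Dirichlet behaviour (2.3)
at `θ = 0`, and the one-sided Neumann condition (2.12) of the window average at `θ = 2π`.
[cite: LawlerSchrammWernerEJP2002, Lemma 2.2, (2.2)–(2.4), (2.12)] -/
theorem isHittingPDEData_lswHit : IsHittingPDEData (lswHit 6) (lswHitDθ 6) (lswHitDθθ 6) (lswHitDt 6) := by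
  have hγ := lswInitCoeff_hyp h6
  refine ⟨antitone_lswHit, fun θ _ t => lswHit_mem_Icc θ t, fun θ hθ t => lswHit_pos hθ t,
    fun θ hθ t ht => ⟨?_, ?_, ?_⟩, ?_, ?_, ?_, fun θ hθ t _ => ?_, fun t ht => ⟨?_, ?_⟩, fun t ht => ?_⟩
  · -- `∂_θ`
    have h := hasDerivAt_lswSeries_θ h6 hγ hθ ht
    refine h.congr_of_eventuallyEq ?_
    filter_upwards [clampTwoPi_eventuallyEq hθ] with x hx
    rw [lswHit, if_neg (not_le.2 ht), hx]
  · exact hasDerivAt_lswSeriesDθ_θ h6 hγ hθ ht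
  · -- `∂ₜ`
    have h := hasDerivAt_lswSeries_t h6 hγ hθ ht
    refine h.congr_of_eventuallyEq ?_
    filter_upwards [lt_mem_nhds (show (0 : ℝ) < t from ht)] with s hs
    rw [lswHit, if_neg (not_le.2 hs), clampTwoPi_of_mem (Ioo_subset_Icc_self hθ)]
  · exact continuousOn_lswSeriesDθ h6 hγ
  · exact continuousOn_lswSeriesDθθ h6 hγ
  · exact continuousOn_lswSeriesDt h6 hγ
  · exact lswOp_lswSeries h6 hθ
  · rw [lswHit, if_neg (not_le.2 ht), clampTwoPi_of_mem ⟨le_rfl, by positivity⟩]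
    exact lswSeries_init_zero h6 t
  · refine (tendsto_lswSeries_zero h6 hγ ht).congr' ?_
    filter_upwards [Ioo_mem_nhdsGT (by positivity : (0 : ℝ) < 2 * π)] with θ hθ
    rw [lswHit, if_neg (not_le.2 ht), clampTwoPi_of_mem (Ioo_subset_Icc_self hθ)]
  · -- the window Neumann condition at `2π`
    set V : Set ℝ := Ioo π (2 * π) with hV
    have hVsub : V ⊆ Ioo 0 (2 * π) := fun x hx => ⟨by linarith [hx.1, Real.pi_pos], hx.2⟩
    have hVmem : V ∈ 𝓝[<] (2 * π) := Ioo_mem_nhdsLT (by linarith [Real.pi_pos])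
    obtain ⟨M, hM0, hM⟩ := exists_bound_lswSeriesDθ h6 hγ ht
    have hIoc : Set.uIoc (0 : ℝ) 1 = Ioc 0 1 := uIoc_of_le zero_le_one
    -- the integrand on `[0, 1]` for angles in `[0, 2π]`
    have hF : ∀ x ∈ Icc 0 (2 * π), ∀ s ∈ Icc (0 : ℝ) 1,
        lswHit 6 x (t + s) = lswSeries 6 (lswInitCoeff 6) x (t + s) := fun x hx s hs =>
      lswHit_of_pos (by linarith [hs.1]) hx
    -- measurability/continuity in `s` for `x ∈ (0, 2π]`
    have hcontF : ∀ x ∈ Ioc 0 (2 * π), ContinuousOn (fun s => lswHit 6 x (t + s)) (Icc 0 1) := by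
      intro x hx
      have h := (continuousOn_lswSeries_init_t hx).comp (continuous_const.add continuous_id).continuousOn
        (fun s hs => show t + s ∈ Ioi 0 by simp only [mem_Ioi]; linarith [hs.1] : MapsTo (fun s : ℝ => t + s)
          (Icc (0 : ℝ) 1) (Ioi 0))
      exact h.congr fun s hs => hF x ⟨hx.1.le, hx.2⟩ s hs
    have hmeasF : ∀ x ∈ Ioc 0 (2 * π),
        AEStronglyMeasurable (fun s => lswHit 6 x (t + s)) (volume.restrict (Set.uIoc 0 1)) := by
      intro x hx
      rw [hIoc]
      exact ((hcontF x hx).mono Ioc_subset_Icc_self).aestronglyMeasurable measurableSet_Ioc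
    -- derivative of the window average inside `V`
    have hderivV : ∀ x₀ ∈ V, HasDerivAt (fun x => ∫ s in (0 : ℝ)..1, lswHit 6 x (t + s))
        (∫ s in (0 : ℝ)..1, lswHitDθ 6 x₀ (t + s)) x₀ := by
      intro x₀ hx₀
      have hx₀' := hVsub hx₀
      refine hasDerivAt_tildeAvg_param (F := lswHit 6) (F' := lswHitDθ 6) (C := M) (V := V)
        (Ioo_mem_nhds hx₀.1 hx₀.2)
        (fun x hx => hmeasF x ⟨(hVsub hx).1, (hVsub hx).2.le⟩)
        ((hcontF x₀ ⟨hx₀'.1, hx₀'.2.le⟩).intervalIntegrable_of_Icc zero_le_one) ?_ ?_ ?_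
      · -- continuity of `s ↦ u_θ(x₀, t + s)`
        have h := (continuousOn_lswSeriesDθ h6 hγ).comp
          (f := fun s : ℝ => (x₀, t + s)) (by fun_prop : Continuous fun s : ℝ => (x₀, t + s)).continuousOn
          (fun s hs => ⟨hx₀', show t + s ∈ Ioi 0 by simp only [mem_Ioi]; linarith [hs.1]⟩ :
            MapsTo (fun s : ℝ => (x₀, t + s)) (Icc (0 : ℝ) 1) (Ioo 0 (2 * π) ×ˢ Ioi 0))
        exact h
      · intro x hx s hs
        have h := hM x hx (t + s) (by linarith [hs.1])
        have hcos : Real.cos (x / 4) ≤ 1 := Real.cos_le_one _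
        exact h.trans (by nlinarith)
      · intro x hx s hs
        have h := hasDerivAt_lswSeries_θ h6 hγ (hVsub hx) (show 0 < t + s by linarith [hs.1])
        refine h.congr_of_eventuallyEq ?_
        filter_upwards [Ioo_mem_nhds (hVsub hx).1 (hVsub hx).2] with y hy
        exact hF y (Ioo_subset_Icc_self hy) s hs
    have hdiff : DifferentiableOn ℝ (fun x => ∫ s in (0 : ℝ)..1, lswHit 6 x (t + s)) V :=
      fun x hx => (hderivV x hx).differentiableAt.differentiableWithinAt
    -- continuity of the window average at `2π` from the left
    have hcont : ContinuousWithinAt (fun x => ∫ s in (0 : ℝ)..1, lswHit 6 x (t + s)) V (2 * π) := by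
      refine intervalIntegral.continuousWithinAt_of_dominated_interval (bound := fun _ => 1) ?_ ?_
        intervalIntegrable_const ?_
      · filter_upwards [self_mem_nhdsWithin] with x hx
        exact hmeasF x ⟨(hVsub hx).1, (hVsub hx).2.le⟩
      · refine Eventually.of_forall fun x => ae_of_all _ fun s _ => ?_
        rw [Real.norm_eq_abs, abs_le]
        have := lswHit_mem_Icc x (t + s)
        exact ⟨by linarith [this.1], this.2⟩
      · refine ae_of_all _ fun s hs => ?_
        rw [hIoc] at hs
        have h2π : (2 * π) ∈ Ioc 0 (2 * π) := ⟨by positivity, le_rfl⟩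
        have h := continuousWithinAt_lswSeries_two_pi h6 hγ (show 0 < t + s by linarith [hs.1])
        refine h.congr (fun y hy => hF y (Ioo_subset_Icc_self (hVsub hy)) s ⟨hs.1.le, hs.2⟩) ?_
        exact hF _ ⟨h2π.1.le, h2π.2⟩ s ⟨hs.1.le, hs.2⟩
    -- the derivative tends to `0`
    have htend : Tendsto (fun x => deriv (fun x => ∫ s in (0 : ℝ)..1, lswHit 6 x (t + s)) x)
        (𝓝[<] (2 * π)) (𝓝 0) := by
      have hcos : Tendsto (fun θ : ℝ => M * Real.cos (θ / 4)) (𝓝[<] (2 * π)) (𝓝 0) := by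
        have : Tendsto (fun θ : ℝ => M * Real.cos (θ / 4)) (𝓝 (2 * π))
            (𝓝 (M * Real.cos (2 * π / 4))) :=
          ((Real.continuous_cos.comp (continuous_id.div_const (4 : ℝ))).tendsto (2 * π)).const_mul M
        rw [show 2 * π / 4 = π / 2 by ring, Real.cos_pi_div_two, mul_zero] at this
        exact this.mono_left nhdsWithin_le_nhds
      refine squeeze_zero_norm' ?_ hcos
      filter_upwards [hVmem] with x hx
      rw [(hderivV x hx).deriv, Real.norm_eq_abs]
      have hb : ∀ s ∈ Set.uIoc (0 : ℝ) 1, ‖lswHitDθ 6 x (t + s)‖ ≤ M * Real.cos (x / 4) := by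
        intro s hs
        rw [hIoc] at hs
        rw [Real.norm_eq_abs]
        exact hM x hx (t + s) (by linarith [hs.1])
      have := intervalIntegral.norm_integral_le_of_norm_le_const hb
      rw [Real.norm_eq_abs] at this
      simpa using this
    have key := hasDerivWithinAt_Iic_of_tendsto_deriv hdiff hcont hVmem htend
    exact key

/-- For `t ≤ 0` the identification is automatic: `u(2π, t) = 1` and `𝔯 ≤ 1 ≤ e^{-t}` always
(Schwarz), so `ν{𝔯 ≤ e^{-t}} = 1` for every probability measure `ν`. [folklore] -/
theorem lswHit_two_pi_eq_measureReal_of_nonpos (ν : ProbabilityMeasure (TopologicalSpace.NonemptyCompacts ℂ))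
    {t : ℝ} (ht : t ≤ 0) :
    lswHit 6 (2 * π) t = (ν : Measure (TopologicalSpace.NonemptyCompacts ℂ)).real
      {K | Literature.Analysis.Complex.conformalRadius (K : Set ℂ) ≤ Real.exp (-t)} := by
  rw [lswHit, if_pos ht]
  have : {K : TopologicalSpace.NonemptyCompacts ℂ |
      Literature.Analysis.Complex.conformalRadius (K : Set ℂ) ≤ Real.exp (-t)} = univ := by
    refine eq_univ_of_forall fun K => ?_
    exact (Literature.Analysis.Complex.conformalRadius_le_one _).trans (Real.one_le_exp (by linarith))
  rw [this, probReal_univ]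

/-- **`LawlerSchrammWerner2002_hittingPDE` reduced to the identification of the trace.** If, for
the weak limit `ν` of `lswLaw` and every `t > 0`, the distribution function of the conformal radius
equals the trace at `θ = 2π` of the semigroup solution, `ν{K | 𝔯(K) ≤ e^{-t}} = u(2π, t)` (LSW's
(2.2) at `θ = 2π` combined with Thm. 2.1, (2.7)–(2.10) and Lemma 2.3 — the probabilistic half,
which needs the convergence of the percolation exploration path to `SLE₆`), then the named fact
holds, with `h = lswHit 6`; the case `t ≤ 0` is automatic
(`lswHit_two_pi_eq_measureReal_of_nonpos`). [cite: LawlerSchrammWernerEJP2002, Lemma 2.2,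
(2.2), (2.3), Lemma 2.3] -/
theorem LawlerSchrammWerner2002_hittingPDE_of_trace
    (htrace : ∀ ν : ProbabilityMeasure (TopologicalSpace.NonemptyCompacts ℂ),
      Tendsto lswLaw atTop (𝓝 ν) → ∀ t : ℝ, 0 < t → lswHit 6 (2 * π) t =
        (ν : Measure (TopologicalSpace.NonemptyCompacts ℂ)).real
          {K | Literature.Analysis.Complex.conformalRadius (K : Set ℂ) ≤ Real.exp (-t)}) :
    LawlerSchrammWerner2002_hittingPDE := by
  intro ν hν
  have H := isHittingPDEData_lswHit
  refine ⟨lswHit 6, lswHitDθ 6, lswHitDθθ 6, lswHitDt 6, fun t => ?_, H.antitone, H.mem_Icc, H.pos,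
    H.hasDerivAt, H.continuousOn_θ, H.continuousOn_θθ, H.continuousOn_t, H.pde, H.dirichlet,
    H.neumann⟩
  rcases le_or_gt t 0 with ht | ht
  · exact lswHit_two_pi_eq_measureReal_of_nonpos ν ht
  · exact htrace ν hν t ht

end Six

end Literature.Probability.Percolation
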